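import Mathlib
import HarnessLib.Audit
import Summits.PneNP.PneNP.Theorems.PstarChordReadSwitches

/-!
# Two generic chords kill every reading without shared switch partners (ROUND-24, O1 at exact tightness; memo g20 §11 assembly)

FRONTIER range-avoidance ladder, rung F-N3, ROUND 24 (cell `pnp-ideate`, prover-2 memos `g19/O1-CHORD-READ.md`, `g20/O1-CHORD-READ-g20.md` §10–§11;
typed target `PstarCoreBoundTargets.TerminalPeelable` (p646951); restricted-model proof complexity — nothing here bears on `P` versus `NP`).

The citation point of the chord-read programme for the SIMPLE MENU.  A reading of the core is SIMPLE AT the chord `c` if every monomial of `Γ₁, Γ₂`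
touching the AND pair of `c` is a switch gate (`PstarChordReadSwitches.IsSwitch`: AND pair `{v, z}`, `v` a private of `c`, `z` outside the core and in
no other monomial) — in particular a monomial-free chord is simply read.

* `false_of_two_generic_simply_read` — a terminal core (pure, typed, simple overlaps, `(r,3/2)`-expanding) has NO two distinct slice-generic chords
  at which the reading is simple: if one of them is monomial-free, `PstarChordReadLemma.false_of_monomial_free_chord`; otherwise both are
  switch-gated and `PstarChordReadSwitches.false_of_two_switchGated`.

For the 1800 tight `k = 12` O1 structures (six chords, ≥ 5 slice-generic for every `y` by kit j314774) this leaves exactly the readings in which at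
least four generic chords have a switch partner SHARED with another monomial (`(σ, z)` or `(z, z′)`; `(p′, z)` is illegal at tightness) — memo g20
§11 R2/R3.  No Assumption A.
-/

set_option linter.dupNamespace false -- `Summit.PneNP.PneNP.…`: summit = sub-problem name (D-0017 single-conjunct layout)

open Finset Literature.Computability.Complexity
open Summit.PneNP.PneNP.Theorems.PstarTyped (Typed)
open Summit.PneNP.PneNP.Theorems.PstarSALevel (varSet bdry BoundaryExpanding SimpleOverlap)
open Summit.PneNP.PneNP.Theorems.PstarChordRepair (IsChord)
open Summit.PneNP.PneNP.Theorems.PstarCoreBoundTargets (Terminal)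
open Summit.PneNP.PneNP.Theorems.PstarChordReadLemma (SliceGeneric false_of_monomial_free_chord)
open Summit.PneNP.PneNP.Theorems.PstarChordReadSwitches (Touches IsSwitch SwitchGated false_of_two_switchGated)

namespace Summit.PneNP.PneNP.Theorems.PstarChordReadMenu

variable {n m : ℕ}

/-- **Two slice-generic simply-read chords kill a terminal core.**  `hmenuᵢ/ⱼ`: every monomial of `w₁, w₂` touching the AND pair of `cᵢ` (resp.
`cⱼ`) is a switch gate; monomial-free chords are included (vacuously). -/
theorem false_of_two_generic_simply_read {r : ℕ} (I : LocalMap 4 n m) (hI : I.IsPure xorAndPred) (hT : Typed I) (hS : SimpleOverlap I)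
    (hB : BoundaryExpanding r I) {y : Fin m → Bool} {J₀ : Finset (Fin m)} {w₁ w₂ : Finset (Fin n) × Finset (Fin m) × Bool}
    (ht : Terminal I r y J₀ w₁ w₂) {cᵢ cⱼ : Fin m} (hcᵢ : cᵢ ∈ J₀) (hcⱼ : cⱼ ∈ J₀) (hne : cᵢ ≠ cⱼ) (hchᵢ : IsChord I J₀ cᵢ)
    (hchⱼ : IsChord I J₀ cⱼ) (hmenuᵢ : ∀ g ∈ w₁.2.1 ∪ w₂.2.1, Touches I cᵢ g → ∃ v z, IsSwitch I J₀ w₁ w₂ cᵢ g v z)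
    (hmenuⱼ : ∀ g ∈ w₁.2.1 ∪ w₂.2.1, Touches I cⱼ g → ∃ v z, IsSwitch I J₀ w₁ w₂ cⱼ g v z)
    (hgenᵢ : SliceGeneric I y J₀ cᵢ (w₁.2.1 ∪ w₂.2.1)) (hgenⱼ : SliceGeneric I y J₀ cⱼ (w₁.2.1 ∪ w₂.2.1)) : False := by
  by_cases hᵢ : ∃ g ∈ w₁.2.1 ∪ w₂.2.1, Touches I cᵢ g
  · by_cases hⱼ : ∃ g ∈ w₁.2.1 ∪ w₂.2.1, Touches I cⱼ g
    · exact false_of_two_switchGated hI hT hS hB ht hcᵢ hcⱼ hne hchᵢ hchⱼ ⟨hᵢ, hmenuᵢ⟩ ⟨hⱼ, hmenuⱼ⟩ hgenᵢ hgenⱼ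
    · push Not at hⱼ
      exact false_of_monomial_free_chord I hI hT hS hB ht hcⱼ hchⱼ (fun g hg => not_not.1 (hⱼ g hg)) hgenⱼ
  · push Not at hᵢ
    exact false_of_monomial_free_chord I hI hT hS hB ht hcᵢ hchᵢ (fun g hg => not_not.1 (hᵢ g hg)) hgenᵢ

end Summit.PneNP.PneNP.Theorems.PstarChordReadMenu
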